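import Literature.Topology.FourManifolds.LatticeFormsSplitting
import Literature.Topology.FourManifolds.LatticeFormsUnitBasis
import Literature.Topology.FourManifolds.LatticeFormsRepresentsZero
import Mathlib.LinearAlgebra.FreeModule.PID
import HarnessLib

/-!
# Odd indefinite unimodular lattices are `s I₊ ⊕ t I₋` (Serre, *A Course in Arithmetic*, Ch. V Thm 4)

Trunk T-4MAN; part of the decomposition of the named fact
`LinearMap.BilinForm.equivalent_of_isIndefinite` (Serre, Ch. V §2.2 Thm 6). From Serre's
Theorem 3 (the named fact `exists_isotropic_of_isIndefinite` of `LatticeFormsRepresentsZero.lean`,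
taken as a hypothesis) we prove

* **Theorem 4** (`isDiagonalizable_of_isOdd_of_isIndefinite`): a symmetric unimodular lattice of
  type I (odd) which is indefinite has an orthogonal `ℤ`-basis — by
  `apply_basis_self_eq_one_or_of_isOrthoᵢ` its squares are `±1`, i.e. `E ≅ s I₊ ⊕ t I₋`;
* the **type I case of Theorem 6** (`equivalent_of_isOdd_of_isIndefinite`): two such lattices
  with the same rank and signature are isometric (Serre's Corollary-to-Thm-4 bookkeeping,
  `equivalent_of_isOrthoᵢ_of_sq_eq_one_or`).

## Proof (Serre, Ch. V §3.3)

Lemma 4: Theorem 3 gives `x ≠ 0` with `x.x = 0`; Lemma 3 makes it indivisible with `x.y = 1`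
(`exists_isotropic_dual_pair`); type I gives `e₁, e₂` with `e₁.e₁ = 1`, `e₂.e₂ = -1`, `e₁.e₂ = 0`
(`exists_orthogonal_unit_pair_of_isOdd`). Then induction on the rank: by Lemma 2
`E ≅ I₊ ⊕ e₁^⊥` with `e₁^⊥ ∋ e₂` odd unimodular of rank `n − 1`; if it is indefinite, induct. If
not, it is negative definite, and one uses `E ≅ I₋ ⊕ e₂^⊥` instead: `e₂^⊥ ∋ e₁` is odd, not
negative definite, and not positive definite either because `e₁^⊥ ∩ e₂^⊥ ≠ 0` as soon as
`n ≥ 3` (ranks `(n−1) + (n−1) > n`); for `n = 2`, `e₂^⊥` has rank `1` and any basis is orthogonal.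
(Serre phrases the same dichotomy as "one of the modules `I₊ ⊕ F`, `I₋ ⊕ F` is indefinite".)

`ℤ`-lattices carry the canonical structure `AddCommGroup.toIntModule` (only `[AddCommGroup M]` is
assumed), see `LatticeFormsOrthoSum.lean`.

## Sources

* J.-P. Serre, *A Course in Arithmetic* (GTM 7, Springer 1973), Ch. V §2.2 Thm 4 and its
  Corollary, §3.3 (Lemma 4, proof of Thm 4). [Serre1973]
* J. Milnor, D. Husemoller, *Symmetric bilinear forms* (Springer 1973), Ch. II §4
  (Thm 4.3: classification of odd indefinite unimodular forms). [MilnorHusemoller1973]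
-/

open Module
open LinearMap (BilinForm)

universe u v

namespace LinearMap.BilinForm

/-! ### Diagonalisability: small rank, rank one summands, orthogonal sums -/

section Diagonalizable

variable {M : Type*} [AddCommGroup M]

/-- A lattice of rank `≤ 1` is diagonalisable over `ℤ`: any basis (at most one vector) is
orthogonal. [folklore] -/
theorem isDiagonalizable_of_finrank_le_one [Module.Finite ℤ M] [Module.Free ℤ M]
    (B : BilinForm ℤ M) (h : finrank ℤ M ≤ 1) : B.IsDiagonalizable := by
  refine ⟨Fin (finrank ℤ M), Module.finBasis ℤ M, fun i j hij => ?_⟩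
  exact absurd (Fin.ext (by omega)) hij

/-- The rank-one form `⟨ε⟩ = ε • (xy)` on `ℤ` is diagonalisable (basis `{1}`). [folklore] -/
theorem isDiagonalizable_smul_mul (ε : ℤ) : BilinForm.IsDiagonalizable (ε • LinearMap.mul ℤ ℤ) :=
  ⟨Unit, Basis.singleton Unit ℤ, fun i j hij => absurd (Subsingleton.elim i j) hij⟩

/-- An orthogonal sum of diagonalisable forms is diagonalisable (concatenate the orthogonal
bases). [folklore] -/
theorem IsDiagonalizable.prod {M₁ M₂ : Type*} [AddCommGroup M₁] [AddCommGroup M₂]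
    {B₁ : BilinForm ℤ M₁} {B₂ : BilinForm ℤ M₂} (h₁ : B₁.IsDiagonalizable)
    (h₂ : B₂.IsDiagonalizable) : (B₁.prod B₂).IsDiagonalizable := by
  obtain ⟨ι₁, b₁, hb₁⟩ := h₁
  obtain ⟨ι₂, b₂, hb₂⟩ := h₂
  refine ⟨ι₁ ⊕ ι₂, b₁.prod b₂, ?_⟩
  rintro (i | i) (j | j) hij
  · have h0 : B₁ (b₁ i) (b₁ j) = 0 := hb₁ fun h => hij (congrArg Sum.inl h)
    simp [Function.onFun, Basis.prod_apply, h0]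
  · simp [Function.onFun, Basis.prod_apply]
  · simp [Function.onFun, Basis.prod_apply]
  · have h0 : B₂ (b₂ i) (b₂ j) = 0 := hb₂ fun h => hij (congrArg Sum.inr h)
    simp [Function.onFun, Basis.prod_apply, h0]

/-- **Lemma 2 ⇒ diagonalisability descends from `u^⊥`**: if `B u u = ε`, `ε² = 1`, and the
restriction of `B` to `u^⊥` is diagonalisable, then `B` is (`E = ℤu ⊕ u^⊥`, Serre, *A Course
in Arithmetic*, Ch. V §3.2 Lemma 2). [cite: Serre1973, Ch. V §3.2 Lemma 2] -/
theorem isDiagonalizable_of_restrict_orthogonal_singleton {B : BilinForm ℤ M} (hB : B.IsSymm)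
    (u : M) {ε : ℤ} (hu : B u u = ε) (hε : ε * ε = 1)
    (h : (B.restrict (B.orthogonal (ℤ ∙ u))).IsDiagonalizable) : B.IsDiagonalizable :=
  IsDiagonalizable.of_equivalent ⟨(IsometryEquiv.splitUnit hB u hu hε).symm⟩
    ((isDiagonalizable_smul_mul ε).prod h)

/-- Rank bookkeeping for Lemma 2: `rank E = 1 + rank u^⊥`. [folklore] -/
theorem finrank_eq_finrank_orthogonal_singleton_add_one [Module.Finite ℤ M] [Module.Free ℤ M]
    {B : BilinForm ℤ M} (hB : B.IsSymm) (u : M) {ε : ℤ} (hu : B u u = ε) (hε : ε * ε = 1) :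
    finrank ℤ M = finrank ℤ (B.orthogonal (ℤ ∙ u)) + 1 := by
  rw [(IsometryEquiv.splitUnit hB u hu hε).toLinearEquiv.finrank_eq, Module.finrank_prod,
    Module.finrank_self, add_comm]

end Diagonalizable

/-! ### Theorem 4 -/

section Thm4

/-- **Serre's Theorem 4, inductive form.** Assuming Theorem 3 (`exists_isotropic_of_isIndefinite`),
every symmetric unimodular odd indefinite lattice of rank `≤ n` has an orthogonal basis.
Induction on `n` following Serre, *A Course in Arithmetic*, Ch. V §3.3 (see the file header).
[cite: Serre1973, Ch. V §2.2 Thm 4, §3.3] -/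
theorem isDiagonalizable_of_isOdd_of_isIndefinite_aux (h3 : exists_isotropic_of_isIndefinite.{u})
    (n : ℕ) : ∀ (M : Type u) [AddCommGroup M] [Module.Finite ℤ M] [Module.Free ℤ M]
      (B : BilinForm ℤ M), finrank ℤ M ≤ n → B.IsSymm → B.IsUnimodular → B.IsOdd →
      B.IsIndefinite → B.IsDiagonalizable := by
  induction n with
  | zero =>
    intro M _ _ _ B hn _ _ _ _
    exact isDiagonalizable_of_finrank_le_one B (by omega)
  | succ n ih =>
    intro M _ _ _ B hn hB hu hodd hind
    haveI : B.IsPerfPair := hu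
    -- Theorem 3 and Lemma 3: an isotropic `x` and `y` with `x.y = 1`
    obtain ⟨x₀, hx₀0, hx₀⟩ := h3 B hB hu hind
    obtain ⟨x, y, hx, hxy⟩ := exists_isotropic_dual_pair hx₀0 hx₀
    -- Lemma 4: `u.u = 1`, `w.w = -1`, `u.w = 0`
    obtain ⟨u, w, huu, hww, huw⟩ := exists_orthogonal_unit_pair_of_isOdd hB hodd hx hxy
    have hwu : B w u = 0 := by rw [hB.eq w u, huw]
    have hu0 : u ≠ 0 := fun h0 => by simp [h0] at huu
    have hw0 : w ≠ 0 := fun h0 => by simp [h0] at hww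
    -- the two complements
    set U : Submodule ℤ M := B.orthogonal (ℤ ∙ u) with hUdef
    set W : Submodule ℤ M := B.orthogonal (ℤ ∙ w) with hWdef
    have hwU : w ∈ U := (mem_orthogonal_span_singleton_iff B).mpr huw
    have huW : u ∈ W := (mem_orthogonal_span_singleton_iff B).mpr hwu
    have hU1 : finrank ℤ M = finrank ℤ U + 1 :=
      finrank_eq_finrank_orthogonal_singleton_add_one hB u huu (by norm_num)
    have hW1 : finrank ℤ M = finrank ℤ W + 1 :=
      finrank_eq_finrank_orthogonal_singleton_add_one hB w hww (by norm_num)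
    have hUu : (B.restrict U).IsUnimodular :=
      isUnimodular_restrict_orthogonal_singleton hu hB u huu (by norm_num)
    have hWu : (B.restrict W).IsUnimodular :=
      isUnimodular_restrict_orthogonal_singleton hu hB w hww (by norm_num)
    have hUodd : (B.restrict U).IsOdd :=
      (isOdd_iff _).mpr ⟨⟨w, hwU⟩, by change Odd (B w w); rw [hww]; decide⟩
    have hWodd : (B.restrict W).IsOdd :=
      (isOdd_iff _).mpr ⟨⟨u, huW⟩, by change Odd (B u u); rw [huu]; decide⟩
    by_cases hUind : (B.restrict U).IsIndefinite
    · -- `E ≅ I₊ ⊕ u^⊥` with `u^⊥` odd indefinite of smaller rank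
      exact isDiagonalizable_of_restrict_orthogonal_singleton hB u huu (by norm_num)
        (ih U (B.restrict U) (by omega) (hB.restrict U) hUu hUodd hUind)
    · -- `u^⊥` is definite, hence negative definite (it contains `w`); use `E ≅ I₋ ⊕ w^⊥`
      have hUneg : (B.restrict U).NegDef := by
        rcases not_not.mp hUind with hpos | hneg
        · have h := (posDef_iff _).mp hpos ⟨w, hwU⟩ (fun h0 => hw0 (congrArg Subtype.val h0))
          change 0 < B w w at h
          rw [hww] at h
          exact absurd h (by decide)
        · exact hneg
      refine isDiagonalizable_of_restrict_orthogonal_singleton hB w hww (by norm_num) ?_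
      by_cases hW2 : finrank ℤ W ≤ 1
      · exact isDiagonalizable_of_finrank_le_one _ hW2
      · -- `rank ≥ 3`: `u^⊥ ∩ w^⊥ ≠ 0` gives a vector of negative square in `w^⊥`
        have hz : ∃ z, z ∈ U ∧ z ∈ W ∧ z ≠ 0 := by
          by_contra hcon
          push Not at hcon
          have hdis : Disjoint U W := by
            rw [Submodule.disjoint_def]
            exact fun z hzU hzW => hcon z hzU hzW
          have := finrank_add_finrank_le_of_disjoint_of_isDomain hdis
          omega
        obtain ⟨z, hzU, hzW, hz0⟩ := hz
        have hzneg : B z z < 0 := by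
          have := (negDef_iff _).mp hUneg ⟨z, hzU⟩ (fun h0 => hz0 (congrArg Subtype.val h0))
          simpa using this
        have hWind : (B.restrict W).IsIndefinite :=
          isIndefinite_of_apply_self_neg_of_pos (x := ⟨z, hzW⟩) (y := ⟨u, huW⟩)
            (by change B z z < 0; exact hzneg) (by change 0 < B u u; rw [huu]; decide)
        exact ih W (B.restrict W) (by omega) (hB.restrict W) hWu hWodd hWind

/-- **Serre's Theorem 4** (from Theorem 3). A symmetric unimodular lattice of type I (odd) which
is indefinite admits an orthogonal `ℤ`-basis; its squares are then `±1`
(`apply_basis_self_eq_one_or_of_isOrthoᵢ`), i.e. "`E` is isomorphic to `s I₊ ⊕ t I₋`"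
(Serre, *A Course in Arithmetic*, Ch. V §2.2 Thm 4; proof §3.3). The hypothesis `h3` is
Serre's Theorem 3 (named fact `exists_isotropic_of_isIndefinite`).
[cite: Serre1973, Ch. V §2.2 Thm 4] -/
theorem isDiagonalizable_of_isOdd_of_isIndefinite (h3 : exists_isotropic_of_isIndefinite.{u})
    {M : Type u} [AddCommGroup M] [Module.Finite ℤ M] [Module.Free ℤ M] {B : BilinForm ℤ M}
    (hB : B.IsSymm) (hu : B.IsUnimodular) (hodd : B.IsOdd) (hind : B.IsIndefinite) :
    B.IsDiagonalizable :=
  isDiagonalizable_of_isOdd_of_isIndefinite_aux h3 (finrank ℤ M) M B le_rfl hB hu hodd hind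

/-- **Theorem 6, type I case** (from Theorem 3). Two symmetric unimodular odd indefinite
lattices with the same rank and the same signature are isometric: both are `s I₊ ⊕ t I₋` with
`s + t = r`, `s − t = τ` (Serre, *A Course in Arithmetic*, Ch. V §2.2, Thm 4 and Thm 6 "since
the same is true for type I (cf. theorem 4)"). [cite: Serre1973, Ch. V §2.2 Thms 4, 6] -/
theorem equivalent_of_isOdd_of_isIndefinite (h3 : exists_isotropic_of_isIndefinite.{u})
    (h3' : exists_isotropic_of_isIndefinite.{v})
    {M : Type u} {M' : Type v} [AddCommGroup M] [Module.Finite ℤ M] [Module.Free ℤ M]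
    [AddCommGroup M'] [Module.Finite ℤ M'] [Module.Free ℤ M']
    {B : BilinForm ℤ M} {B' : BilinForm ℤ M'}
    (hB : B.IsSymm) (hu : B.IsUnimodular) (hodd : B.IsOdd) (hind : B.IsIndefinite)
    (hB' : B'.IsSymm) (hu' : B'.IsUnimodular) (hodd' : B'.IsOdd) (hind' : B'.IsIndefinite)
    (hrank : finrank ℤ M = finrank ℤ M') (hsig : B.signature = B'.signature) :
    B.Equivalent B' := by
  obtain ⟨ι, b, hb⟩ := isDiagonalizable_of_isOdd_of_isIndefinite h3 hB hu hodd hind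
  obtain ⟨ι', b', hb'⟩ := isDiagonalizable_of_isOdd_of_isIndefinite h3' hB' hu' hodd' hind'
  haveI : Finite ι := Module.Finite.finite_basis b
  haveI : Finite ι' := Module.Finite.finite_basis b'
  haveI : Fintype ι := Fintype.ofFinite ι
  haveI : Fintype ι' := Fintype.ofFinite ι'
  exact equivalent_of_isOrthoᵢ_of_sq_eq_one_or hb hb'
    (apply_basis_self_eq_one_or_of_isOrthoᵢ hu hb) (apply_basis_self_eq_one_or_of_isOrthoᵢ hu' hb')
    hrank hsig

end Thm4

end LinearMap.BilinForm
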